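import Summits.ABC.IUTFork.Cor312LogKummerRoute2
import Summits.ABC.IUTFork.Cor312TeamAGapWitnessB
import HarnessLib

/-!
# [IUTchIII] Corollary 3.12 — log-Kummer route II: kernel checks on Team B's residual input (GAP row G-c312-11-1)

Record-only, proof-only companion (D-0012; abc-iut cell, HUMAN RULING D-0067, TEAM B «estimate /
log-Kummer»; written by seat abc-iut-w5-d143 as the RQ7 second-pass audit of `Cor312LogKummerRoute2`);
TAKES NO SIDE. Team B's GAP-LEDGER row G-c312-11-1 nominates `Cor312Vol.QFrobComparison` (pointwise,
`∃ m`, `≤`-form) and its printed uniform-equality form `Cor312Vol.QFrobEqualityAt P 0` as the residual input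
of the log-Kummer route ([IUTchIII] Step (xi-g), kurims `paper:url-4b091feeb646` p. 184 l. 30–34: "two
tautologically equivalent ways to compute the log-volume of the `q`-pilot object at `(1,0)`"). This file
records three kernel facts ABOUT that nominated statement, for the adjudication block
(HOME/plan/ADJUDICATION-SPEC.md §2 (G1′), (G3), §4 (ii)):

* `qFrobComparison_iff_volumeTransport` — under the typed Theorem 3.11 (ii) (a) at the column `n`
  (`Thm311.Column.KummerA`: the Kummer isomorphisms are "compatible with the respective log-volumes
  [cf. Proposition 3.9, (ii)]", p. 155, typed as EQUALITY of the holomorphic reading `frobLogvol m` with the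
  mono-analytic `logvol` on admissible regions, every `m`) and admissibility of the Kummer images
  (`ThetaRegionsAdm`), the layer-2 input `QFrobComparison` is EQUIVALENT to the layer-1 input
  `VolumeTransport` (`Cor312LogKummerRoute`; FACT-LIST F-2146, never assumable). Layer 2 proves `→` only;
  the converse is the same rewriting. Likewise `frobVolumeTransport_iff_volumeTransport` and
  `qFrobEqualityAt_iff` (the `m`-uniform equality form is "`qLocal =` the mono-analytic log-volume of the
  `m`-th Kummer image, in every packet"). So moving the comparison "to the holomorphic side of the
  log-Kummer correspondence" renames the residual input without changing its content at this typing level.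
* QUANTIFIER LEVEL (spec (G1′)): the nominated statement is PER-PACKET (`∀ i vQ, ∃ m`) and PRE-HULL (one
  Kummer image, not the holomorphic hull of the union); the kernel chain of record is
  `QFrobEqualityAt m → QFrobComparison ↔ VolumeTransport → Statement` (`statement_of_qFrobComparison`,
  layer 2), whereas the printed (xi-g) sentence concerns ONE global real number obtained AFTER "formation
  of the holomorphic hull and application of the log-volume". (Recorded here as a docstring; the flag is
  the referee's to set.)
* (G3) at INTERFACE level for THIS row — `thm311_bridgeHyps_adm_not_imp_qFrobComparison`: Team A's gap
  witness (`Cor312Vol.GapWitness.gapFull` / `gapSetting`, seat c312-9) satisfies the WHOLE typed Theorem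
  3.11, every bridge hypothesis, `|log(q)| > 0` and `ThetaRegionsAdm`, and there `QFrobComparison`,
  `FrobVolumeTransport` and every `QFrobEqualityAt m` FAIL (the `q`-image has holomorphic log-volume `−1`,
  every Kummer image `−2`). Hence the nominated input is NOT derivable from {typed Thm 3.11, `BridgeHyps`,
  `AbsLogQPos`, `ThetaRegionsAdm`} over the typed interfaces; whether it holds for the ASSEMBLED real
  setting from the frozen definitions + FACT-LIST is exactly what G-c312-11-1 asks.

Also: the headline `statement_of_thm311` consumes, of `FullSituation.Statement`, only (ii) (a) at the one
column `P.n` (`statement_of_kummerA_at`), and B1's Kummer-exact toy satisfies the printed EQUALITY form at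
the print's position `m = 0` (`qFrobEqualityAt_toySettingNE_zero`). Nothing here asserts or denies any
hypothesis; typed ≠ proved; no side taken. [claim: Mochizuki2012, status: disputed]
[cite: ScholzeStix2018, §2.2 pp. 9–10]
Deliberately NOT here: any real-setting discharge (rows B-2/B-3/B-4, c312-12), the complementary
"not necessary" witness (premises ∧ Statement ∧ ¬QFrobComparison; announced by seat w5-d087), any judgement.
-/

noncomputable section

namespace Summit.ABC

namespace IUTFork

namespace Cor312Vol

open Thm311 Cor312

/-! ## 1. The layer-2 input is the layer-1 input, renamed through (ii) (a) -/

section LatticeLevel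

variable {T : ThetaIndex} {S' : LatticeSituation T} (P : Cor312.Setting S'.toSituation)

/-- Under Thm. 3.11 (ii) (a) at the column `n` (`Column.KummerA`) and admissibility of the Kummer images,
Team B's layer-2 residual input `QFrobComparison` is EQUIVALENT to the layer-1 input `VolumeTransport`:
both sides of the (xi-g) comparison are rewritten by the SAME equalities `frobLogvol m = logvol` on
admissible regions (the `q`-image is admissible by `qRegionAdm_of_hul_adm`). Layer 2 proves `→`
(`volumeTransport_of_frobVolumeTransport ∘ frobVolumeTransport_of_qFrobComparison`). [folklore] -/
theorem qFrobComparison_iff_volumeTransport (hka : (S'.col P.n).KummerA (S'.D P.n))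
    (hadm : ThetaRegionsAdm P) : QFrobComparison P ↔ VolumeTransport P := by
  constructor
  · intro h
    exact volumeTransport_of_frobVolumeTransport hka hadm
      (frobVolumeTransport_of_qFrobComparison hka (qRegionAdm_of_hul_adm P) h)
  · intro h i vQ
    obtain ⟨m, hm⟩ := h i vQ
    refine ⟨m, ?_⟩
    rw [(hka m _ vQ _ (qRegionAdm_of_hul_adm P i vQ)).2, (hka m _ vQ _ (hadm m i vQ)).2]
    exact hm

/-- Likewise the intermediate form: `FrobVolumeTransport ↔ VolumeTransport` under (ii) (a) + admissibility
of the Kummer images. [folklore] -/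
theorem frobVolumeTransport_iff_volumeTransport (hka : (S'.col P.n).KummerA (S'.D P.n))
    (hadm : ThetaRegionsAdm P) : FrobVolumeTransport P ↔ VolumeTransport P := by
  constructor
  · exact volumeTransport_of_frobVolumeTransport hka hadm
  · intro h i vQ
    obtain ⟨m, hm⟩ := h i vQ
    refine ⟨m, ?_⟩
    rw [(hka m _ vQ _ (hadm m i vQ)).2]
    exact hm

/-- The printed uniform EQUALITY form at position `m`, unfolded through (ii) (a): in every packet the
`q`-pilot contribution `qLocal` EQUALS the mono-analytic log-volume of the `m`-th Kummer image of the
Θ-pilot object. [folklore] -/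
theorem qFrobEqualityAt_iff (hka : (S'.col P.n).KummerA (S'.D P.n)) (hadm : ThetaRegionsAdm P)
    (m : ℤ) :
    QFrobEqualityAt P m ↔ ∀ (i : Fin T.lstar) (vQ : T.VQ),
      P.qLocal (Setting.labelSucc i) vQ =
        (S'.D P.n).logvol (Setting.labelSucc i) vQ (P.thetaRegion m (Setting.labelSucc i) vQ) := by
  refine forall_congr' fun i => forall_congr' fun vQ => ?_
  rw [(hka m _ vQ _ (qRegionAdm_of_hul_adm P i vQ)).2, (hka m _ vQ _ (hadm m i vQ)).2]
  rfl

/-- Consequently the uniform equality form at ANY position `m` gives layer 1's uniform transport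
`VolumeTransportAt P m` under (ii) (a) + admissibility. [folklore] -/
theorem volumeTransportAt_of_qFrobEqualityAt (hka : (S'.col P.n).KummerA (S'.D P.n))
    (hadm : ThetaRegionsAdm P) {m : ℤ} (h : QFrobEqualityAt P m) : VolumeTransportAt P m :=
  fun i vQ => ((qFrobEqualityAt_iff P hka hadm m).1 h i vQ).le

end LatticeLevel

/-! ## 2. What the headline consumes of the typed Theorem 3.11 -/

section FullLevel

variable {T : ThetaIndex} {S'' : FullSituation T} (P : Cor312.Setting S''.toSituation)

/-- BOOKKEEPING for the adjudication sentence (spec §1 NB): `statement_of_thm311` consumes, of the whole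
typed Theorem 3.11 `FullSituation.Statement`, only (ii) (a) `KummerA` at the ONE column `P.n` — the same
conclusion from that conjunct alone (this is `statement_of_qFrobComparison` over the underlying lattice
situation); (i), (ii) (b)(c)/(Ind3), (iii) and all other columns are idle in this route. [folklore] -/
theorem statement_of_kummerA_at (H : BridgeHyps P) (hka : (S''.col P.n).KummerA (S''.D P.n))
    (hadm : ThetaRegionsAdm P) (h : QFrobComparison (S' := S''.toLatticeSituation) P) :
    P.Statement :=
  statement_of_qFrobComparison (S' := S''.toLatticeSituation) P H hka hadm h

end FullLevel

/-! ## 3. (G3) at interface level for the nominated row: Team A's gap witness refutes it -/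

namespace GapWitness

open Cor312.Checks

/-- In Team A's gap witness every region is admissible, so the Kummer images are. [folklore] -/
theorem gapSetting_thetaRegionsAdm : ThetaRegionsAdm gapSetting := fun _ _ _ => trivial

/-- **Team B's nominated input FAILS in Team A's gap witness** (which satisfies the WHOLE typed Thm. 3.11,
every bridge hypothesis, `|log(q)| > 0`, and `ThetaRegionsAdm`): otherwise layer 2's `statement_of_thm311`
would give the typed Cor. 3.12 there, contradicting `gapSetting_not_statement`. (Directly: the `q`-image
`univ` has holomorphic log-volume `−1`, every Kummer image `{0}` has `−2`.) [folklore] -/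
theorem gapSetting_not_qFrobComparison :
    ¬ QFrobComparison (S' := gapFull.toLatticeSituation) gapSetting := fun h =>
  gapSetting_not_statement
    (statement_of_thm311 (S'' := gapFull) gapSetting gapSetting_bridgeHyps gapFull_statement
      gapSetting_thetaRegionsAdm h)

/-- The intermediate form `FrobVolumeTransport` fails there too. [folklore] -/
theorem gapSetting_not_frobVolumeTransport :
    ¬ FrobVolumeTransport (S' := gapFull.toLatticeSituation) gapSetting := fun h =>
  gapSetting_not_statement
    (statement_of_volumeTransport gapSetting gapSetting_bridgeHyps gapSetting_thetaRegionsAdm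
      (volumeTransport_of_frobVolumeTransport (S' := gapFull.toLatticeSituation)
        (gap_partII 0).1 gapSetting_thetaRegionsAdm h))

/-- And the printed uniform equality form fails there at EVERY position `m` (in particular at the print's
`m = 0`, the second decl named by G-c312-11-1). [folklore] -/
theorem gapSetting_not_qFrobEqualityAt (m : ℤ) :
    ¬ QFrobEqualityAt (S' := gapFull.toLatticeSituation) gapSetting m := fun h =>
  gapSetting_not_qFrobComparison (qFrobComparison_of_equalityAt h)

/-- **(G3), interface level, for GAP row G-c312-11-1.** There is an instantiation in which the typed
Theorem 3.11 (i) ∧ (ii) ∧ (iii) holds in full, every bridge hypothesis holds, `|log(q)| > 0`, the Kummer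
images are admissible — and Team B's nominated input `QFrobComparison` is FALSE. Hence the nominated input
is not derivable from these typed interfaces; together with layer 2's `statement_of_thm311` it sits at
exactly the strength the printed proof places at Step (xi-f)/(xi-g) (p. 184). Whether it holds for the
ASSEMBLED real setting from the frozen definitions + FACT-LIST is the open question of the row, not decided
here. [folklore] -/
theorem thm311_bridgeHyps_adm_not_imp_qFrobComparison :
    ∃ (T : ThetaIndex) (F : FullSituation T) (P : Cor312.Setting F.toLatticeSituation.toSituation),
      F.Statement ∧ BridgeHyps P ∧ P.AbsLogQPos ∧ ThetaRegionsAdm P ∧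
        ¬ QFrobComparison (S' := F.toLatticeSituation) P :=
  ⟨toyIndex, gapFull, gapSetting, gapFull_statement, gapSetting_bridgeHyps, gapSetting_absLogQPos,
    gapSetting_thetaRegionsAdm, gapSetting_not_qFrobComparison⟩

/-- The same for the uniform equality form named by the row (`QFrobEqualityAt P 0`). [folklore] -/
theorem thm311_bridgeHyps_adm_not_imp_qFrobEqualityAt_zero :
    ∃ (T : ThetaIndex) (F : FullSituation T) (P : Cor312.Setting F.toLatticeSituation.toSituation),
      F.Statement ∧ BridgeHyps P ∧ P.AbsLogQPos ∧ ThetaRegionsAdm P ∧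
        ¬ QFrobEqualityAt (S' := F.toLatticeSituation) P 0 :=
  ⟨toyIndex, gapFull, gapSetting, gapFull_statement, gapSetting_bridgeHyps, gapSetting_absLogQPos,
    gapSetting_thetaRegionsAdm, gapSetting_not_qFrobEqualityAt 0⟩

end GapWitness

/-! ## 4. Non-vacuity in the printed equality form -/

namespace Checks

/-- On B1's Kummer-exact toy (`toyLatticeNE` / `toySettingNE`) the (xi-g) comparison holds in the printed
uniform EQUALITY form at the print's position `m = 0` (both pilot regions are `univ`). [folklore] -/
theorem qFrobEqualityAt_toySettingNE_zero :
    QFrobEqualityAt (S' := toyLatticeNE) toySettingNE 0 :=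
  fun _ _ => rfl

end Checks

end Cor312Vol

end IUTFork

end Summit.ABC

end
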